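import Literature.MathematicalPhysics.QuantumFieldTheory.Balaban1983to89.T3B8Thm2AtMembers
import Summits.QuantumFields.YangMills.Theorems.UnitScaleTiltMinimiserStabilityRegPrOfEXRowsS55
import Summits.QuantumFields.YangMills.Theorems.UnitScaleTiltProp7Thm2SocketOfCoverForm
import HarnessLib

/-!
# Route `UnitScaleTilt`, crux K1 «MinimiserStabilityRegPr» (stmt-QuantumFields-19200) — **THE CRUX AND THE EX STUB BY NAME, CLOSED MODULO ONE NAMED LITERATURE
# FACT `T3B8Thm2AtMembers.B8Thm2AtT3Members` ([Balaban1985RegularSpaces] THM 2 AT THE T³ FAMILY MEMBERS, print's big-block floor explicit), AND THAT FACT'S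
# RESIDUE BY KERNEL = ITS L = 3 INSTANCE** (chair ★p1 g30; D-0014 ∕ prover prompt «NEED A PUBLISHED FACT» channel under ★★★ director-ym «GO (iii)» 2026-08-30T22:20:33Z
# (C1)–(C3) and ★★OWNER RULING №66; THEOREMS ONLY — 0 `def`, 0 `sorry`, 0 `instance`; `--supports stmt-QuantumFields-19200 --as helper`; registry ∕ route ∕ `closes`
# untouched — J-FREEZE to 2026-09-02 honoured; EMBARGO-LITE №58 honoured — no Thm-2-at-L=3 proof attempt)

Cell `ym3-torus` (HUMAN RULING D-0037; rung R3 = SU(2) YM₃ on T³ — NOT d = 4, NOT infinite volume, NOT a mass gap, NOT Clay).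

WHY.  Since S53 (✓p781947) the EX display's last analytic letter is `hThm2S` = [Balaban1985RegularSpaces] Thm 2 at the `SU(2)` Setup-torus objects of the T³ family members;
★p1 g29 ✓`Prop7Thm2SocketOfCoverForm` proved its body for every `L ≥ 5` and reduced the letter to its `L = 3` instance `hThm2S3`; px16 ✓p783315
`minimiserStabilityRegPr_of_thm2SS55 (hThm2S3) : MinimiserStabilityRegPr`.  Until now that letter was an ANONYMOUS hypothesis text.  The Literature module `T3B8Thm2AtMembers`
(★p1 g30, same evening) gives [B8] Thm 2 at the members a NAME, `B8Thm2AtT3Members : Prop`, WITH PRINT'S STANDING BIG-BLOCK SETTING EXPLICIT as the volume floor `k₀ ≤ F.m`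
(= the hypothesis text of ym-inputs' ✓`BalabanUVNodesN16Thm2SetupTorusOfCover.hThm2S_of_floorS` VERBATIM).  THIS FILE: §1 the floor is no floor (ym-inputs, by name) — the
fact gives the displayed letter `hThm2S` at every block size; the fact at every `L ≥ 5` is a tree theorem (★p1 g29, floor `0`); HENCE the fact is EQUIVALENT to its `L = 3`
instance and to the display letter `hThm2S3` — THE DEBT'S RESIDUE BY KERNEL; §2 the crux BY NAME and the registered EX text from the fact BY NAME.

WHAT IS PROVED (namespace `Summit.QuantumFields.YangMills.Theorems.MinimiserStabilityRegPrOfB8Thm2AtT3Members`).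
* §1 ★`hThm2S_of_b8Thm2AtT3Members` (fact ⇒ `hThm2S` all L, = ✓`hThm2S_of_floorS`), `b8Thm2AtT3Members_body_of_five_le` (floor 0, ✓`hThm2S_body_of_five_le`),
  ★`b8Thm2AtT3Members_of_hThm2S3` (`hThm2S3` ⇒ fact, floor 0 at L = 3), ★★`b8Thm2AtT3Members_iff_hThm2S3 : B8Thm2AtT3Members ↔ ⟨hThm2S3 text⟩`,
  ★★`b8Thm2AtT3Members_iff_three : B8Thm2AtT3Members ↔ ⟨its own L = 3 instance⟩`.
* §2 ★★★ `minimiserStabilityRegPr_of_b8Thm2AtT3Members (hX : B8Thm2AtT3Members) : MinimiserStabilityRegPr` (✓p783315 ∘ §1);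
  ★★ `exStub_of_b8Thm2AtT3Members (hX) : ⟨registered EX text, birth_v10 b15d8e56⟩` (✓`stubEX_of_chartPiecesTwS55` with the parameter letters of ✓p783315 ∘ §1).
HONEST SCOPE.  Plumbing by name; CONDITIONAL on the named fact (trust base = {`B8Thm2AtT3Members`}, open exactly at L = 3); NOTHING at L = 3 proved; 19200 ∕ EX ∕ `YM3TorusSU2` ∕ R3 NOT
proved; credits nothing.  Rung R3 = SU(2) YM₃ on T³ — NOT d = 4, NOT infinite volume, NOT a mass gap, NOT Clay; the Yang–Mills mass gap is NOT proved.
References: T. Bałaban, CMP **99** (1985) 75–102 [Balaban1985RegularSpaces] (Thm 2 p.83, (1.3)–(1.4) p.77, (1.33) p.82, Prop. 6 p.99); CMP **102** (1985) 277–309 [Balaban1985Variational]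
(Thm 1 (6)–(10) pp.278–279, Prop. 7 p.299); CMP **99** (1985) 389–434 [Balaban1985BackgroundPropagators] (p.408); CMP **102** (1985) 255–275 [Balaban1985UV3] ((1)–(3) p.256).
-/

set_option autoImplicit false

noncomputable section

namespace Summit.QuantumFields.YangMills.Theorems.MinimiserStabilityRegPrOfB8Thm2AtT3Members

open scoped Matrix.Norms.L2Operator
open Literature.MathematicalPhysics.QuantumFieldTheory.Balaban1983to89
open Literature.MathematicalPhysics.QuantumFieldTheory.Balaban1983to89.T3ContinuumYM3Torus
open Literature.MathematicalPhysics.QuantumFieldTheory.Balaban1983to89.T3UnitLawDensityEML (ℰp)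
open Literature.MathematicalPhysics.QuantumFieldTheory.Balaban1983to89.T3ConstrainedMinimiser (fibre)
open Literature.MathematicalPhysics.QuantumFieldTheory.Balaban1983to89.T3PrintedRegularMinimiser (RegPr regFibrePr)
open Literature.MathematicalPhysics.QuantumFieldTheory.Balaban1983to89.T3Thm1Carrier
open Literature.MathematicalPhysics.QuantumFieldTheory.Balaban1983to89.T3SectALandauChart (eta)
open Literature.MathematicalPhysics.QuantumFieldTheory.Balaban1983to89.T3B8Thm2AtMembers (B8Thm2AtT3Members b8Thm2AtT3Members_iff)
open B8Thm2SetupTorus (Thm2SetupSUAt)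
open Summit.QuantumFields.YangMills.BalabanUVNodes.N16.Thm2SetupTorusOfCover (hThm2S_of_floorS)
open Summit.QuantumFields.YangMills.Theorems.Prop7Thm2SocketOfCoverForm (hThm2S_of_three hThm2S_body_of_five_le)
open Summit.QuantumFields.YangMills.Theorems.Prop7StubEXOfChartPiecesTwS55 (stubEX_of_chartPiecesTwS55)
open Summit.QuantumFields.YangMills.Theorems.MinimiserStabilityRegPrOfEXRowsS55 (minimiserStabilityRegPr_of_thm2SS55)

/-! ## §1 The floor is no floor; the fact's status by kernel: a theorem at every L ≥ 5, EQUIVALENT to its L = 3 instance and to `hThm2S3` -/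

/-- ★ **THE NAMED FACT GIVES THE DISPLAY LETTER `hThm2S` AT EVERY BLOCK SIZE** — ym-inputs' ✓`hThm2S_of_floorS` («a volume floor is no floor»: every member is
served by its `L^{k₀}`-fold cover through the uniqueness clause; window constant `min c₁ (16B₁)⁻¹`), by name.  CONDITIONAL on `hX`. [cite: Balaban1985RegularSpaces, Thm 2 p.83, p.77] -/
theorem hThm2S_of_b8Thm2AtT3Members (hX : B8Thm2AtT3Members) :
    ∀ (L : ℕ), 1 < L → ∃ B₁ c₁ : ℝ, 0 < B₁ ∧ 0 < c₁ ∧ ∀ (F : T3Family), F.L = L → ∀ (n K : ℕ), n < K →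
      ∃ (β₀ B₂ : ℝ) (len : B7Prop1Explicit.Site (F.P K).d → ℝ),
        Thm2SetupSUAt (F.P K) 2 (K - n) (eta F n K) β₀ B₁ B₂ c₁ len (fun _ => True) :=
  hThm2S_of_floorS (b8Thm2AtT3Members_iff.mp hX)

/-- The fact's body at every block size `L ≥ 5`, floor `k₀ = 0` — ★p1 g29 ✓`hThm2S_body_of_five_le` (lit-balaban's binder-free cover form ✓p720401, `4 ≤ ℓ`), re-read
against the name.  No hypothesis. [cite: Balaban1985RegularSpaces, Thm 2 p.83] -/
theorem b8Thm2AtT3Members_body_of_five_le (L : ℕ) (hL5 : 5 ≤ L) :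
    ∃ (k₀ : ℕ) (B₁ c₁ : ℝ), 0 < B₁ ∧ 0 < c₁ ∧ ∀ (F : T3Family), F.L = L → k₀ ≤ F.m → ∀ (n K : ℕ), n < K →
      ∃ (β₀ B₂ : ℝ) (len : B7Prop1Explicit.Site (F.P K).d → ℝ),
        Thm2SetupSUAt (F.P K) 2 (K - n) (eta F n K) β₀ B₁ B₂ c₁ len (fun _ => True) := by
  obtain ⟨B₁, c₁, hB₁, hc₁, H⟩ := hThm2S_body_of_five_le L hL5
  exact ⟨0, B₁, c₁, hB₁, hc₁, fun F hF _ n K hnK => H F hF n K hnK⟩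

/-- ★ **THE FACT FROM THE DISPLAY LETTER `hThm2S3`** ([B8] Thm 2 at the block-size-3 members, no floor): `L = 3` with floor `0`, `L ≥ 5` by the tree, even `L` vacuous
(✓`hThm2S_of_three`).  CONDITIONAL on `h3`. [cite: Balaban1985RegularSpaces, Thm 2 p.83] -/
theorem b8Thm2AtT3Members_of_hThm2S3
    (h3 : ∃ B₁ c₁ : ℝ, 0 < B₁ ∧ 0 < c₁ ∧ ∀ (F : T3Family), F.L = 3 → ∀ (n K : ℕ), n < K →
      ∃ (β₀ B₂ : ℝ) (len : B7Prop1Explicit.Site (F.P K).d → ℝ),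
        Thm2SetupSUAt (F.P K) 2 (K - n) (eta F n K) β₀ B₁ B₂ c₁ len (fun _ => True)) :
    B8Thm2AtT3Members := by
  refine b8Thm2AtT3Members_iff.mpr fun L hL => ?_
  obtain ⟨B₁, c₁, hB₁, hc₁, H⟩ := hThm2S_of_three h3 L hL
  exact ⟨0, B₁, c₁, hB₁, hc₁, fun F hF _ n K hnK => H F hF n K hnK⟩

/-- ★★ **THE DEBT'S RESIDUE BY KERNEL, FIRST FORM**: the named fact is EQUIVALENT to the EX display's letter `hThm2S3` ([B8] Thm 2 at the block-size-3 members, all members,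
no floor).  Discharging `B8Thm2AtT3Members` = supplying Thm 2 at L = 3 ONLY (lit-balaban `KIdx.hℓ : 4 ≤ ℓ` ℓ = 2 re-edition). [cite: Balaban1985RegularSpaces, Thm 2 p.83] -/
theorem b8Thm2AtT3Members_iff_hThm2S3 :
    B8Thm2AtT3Members ↔
      ∃ B₁ c₁ : ℝ, 0 < B₁ ∧ 0 < c₁ ∧ ∀ (F : T3Family), F.L = 3 → ∀ (n K : ℕ), n < K →
        ∃ (β₀ B₂ : ℝ) (len : B7Prop1Explicit.Site (F.P K).d → ℝ),
          Thm2SetupSUAt (F.P K) 2 (K - n) (eta F n K) β₀ B₁ B₂ c₁ len (fun _ => True) :=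
  ⟨fun hX => hThm2S_of_b8Thm2AtT3Members hX 3 (by norm_num), b8Thm2AtT3Members_of_hThm2S3⟩

/-- ★★ **THE DEBT'S RESIDUE BY KERNEL, SECOND FORM**: the named fact is EQUIVALENT to its own `L = 3` instance (floor allowed). [cite: Balaban1985RegularSpaces, Thm 2 p.83] -/
theorem b8Thm2AtT3Members_iff_three :
    B8Thm2AtT3Members ↔
      ∃ (k₀ : ℕ) (B₁ c₁ : ℝ), 0 < B₁ ∧ 0 < c₁ ∧ ∀ (F : T3Family), F.L = 3 → k₀ ≤ F.m → ∀ (n K : ℕ), n < K →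
        ∃ (β₀ B₂ : ℝ) (len : B7Prop1Explicit.Site (F.P K).d → ℝ),
          Thm2SetupSUAt (F.P K) 2 (K - n) (eta F n K) β₀ B₁ B₂ c₁ len (fun _ => True) := by
  refine ⟨fun hX => (b8Thm2AtT3Members_iff.mp hX) 3 (by norm_num), fun h3 => b8Thm2AtT3Members_iff.mpr fun L hL => ?_⟩
  by_cases h5 : 5 ≤ L
  · exact b8Thm2AtT3Members_body_of_five_le L h5
  by_cases hL3 : L = 3
  · subst hL3; exact h3
  · -- `L ∈ {2, 4}`: even, no member
    refine ⟨0, 1, 1, one_pos, one_pos, fun F hF _ n K hnK => ?_⟩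
    have hev : Even L := by
      rcases (show L = 2 ∨ L = 4 by omega) with h | h <;> subst h <;> decide
    exact absurd (hF ▸ F.hL.1) (Nat.not_odd_iff_even.mpr hev)

/-! ## §2 The crux BY NAME and the registered EX text, CLOSED MODULO the named fact -/

set_option maxHeartbeats 400000 in
-- hb: one `exact` through ✓p783315's instantiated display (README №24 class, same as its source).
/-- ★★★ **`MinimiserStabilityRegPr` ⟸ `B8Thm2AtT3Members`, NOTHING ELSE** — the ROUTE DECL by name, CONDITIONAL on the ONE named Literature fact (✓p783315
`minimiserStabilityRegPr_of_thm2SS55` ∘ §1 at `L = 3`).  Trust base = {`B8Thm2AtT3Members`}; credits nothing; not a registry event.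
[cite: Balaban1985Variational, Thm 1 (6)-(10) pp.278-279, Prop. 7 p.299; Balaban1985RegularSpaces, Thm 2 p.83] -/
theorem minimiserStabilityRegPr_of_b8Thm2AtT3Members (hX : B8Thm2AtT3Members) :
    Summit.QuantumFields.YangMills.Theses.UnitScaleTilt.MinimiserStabilityRegPr :=
  minimiserStabilityRegPr_of_thm2SS55 (hThm2S_of_b8Thm2AtT3Members hX 3 (by norm_num))

set_option maxHeartbeats 400000 in
-- hb: one `exact` through the S55 display with its parameter letters instantiated (README №24 class).
/-- ★★ **THE REGISTERED EX TEXT (`stub_existenceMinimalOrbit`, birth_v10 b15d8e56) ⟸ `B8Thm2AtT3Members`, NOTHING ELSE** — ✓`stubEX_of_chartPiecesTwS55` with `αcap := 1`,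
`c₀ = cB := 1`, `a L i := (1∕1)·(L^{K−n})³` (`ha := le_rfl`), `A₁ := 1` (the choices of ✓p783315 ∕ ✓p790882) and §1 at `L = 3`.  CONDITIONAL; the stub is NOT landed by this
(a stub lands only hypothesis-free). [cite: Balaban1985Variational, Prop. 7 p.299; Balaban1985RegularSpaces, Thm 2 p.83] -/
theorem exStub_of_b8Thm2AtT3Members (hX : B8Thm2AtT3Members) :
    ∀ (L : ℕ), 1 < L → ∀ (B₃ : ℝ), 4 < B₃ → ∃ a₁' O₁ : ℝ, 0 < a₁' ∧ 1 ≤ O₁ ∧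
      ∀ (F : T3Family), F.L = L → ∀ (n K : ℕ) (hnK : n < K) (ε₁ : ℝ), 0 < ε₁ →
        ∀ V : GaugeField (F.P n) 0 (Matrix.specialUnitaryGroup (Fin 2) ℂ), PlaqSmall ε₁ V →
          ∀ U₀ : GaugeField (F.P K) 0 (Matrix.specialUnitaryGroup (Fin 2) ℂ), RegPr F n K ((L : ℝ) ^ 3 * B₃ * ε₁) U₀ → U₀ ∈ fibre F ℰp n K hnK.le V →
            ε₁ ≤ a₁' → ∃ U ∈ regFibrePr F n K hnK.le (O₁ * (L : ℝ) ^ 3 * B₃ * ε₁) V,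
              IsMinOn (fun W : GaugeField (F.P K) 0 (Matrix.specialUnitaryGroup (Fin 2) ℂ) => wilsonAction4 W)
                (regFibrePr F n K hnK.le (O₁ * (L : ℝ) ^ 3 * B₃ * ε₁) V) U := by
  haveI hFL : ∀ F : T3Family, Fact (0 < (F.L : ℝ)) := fun F => ⟨by have h := F.hL.2; exact_mod_cast (lt_trans zero_lt_one h)⟩
  haveI hFη : ∀ (F : T3Family) (k : ℕ), Fact (0 < ((F.L : ℝ)⁻¹) ^ k) := fun F k => ⟨pow_pos (inv_pos.mpr (hFL F).out) k⟩
  haveI hone : ∀ L : ℕ, Fact (0 < ((fun _ : ℕ => (1 : ℝ)) L)) := fun _ => ⟨one_pos⟩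
  have hA₁' : ∀ L : ℕ, 1 < L → ∀ i : Idx L, (fun (L : ℕ) (i : Idx L) => ((1 : ℝ) / 1) * ((i.1.1.L : ℝ) ^ (i.1.2.2 - i.1.2.1)) ^ 3) L i ≤
      (1 : ℝ) * (((1 : ℝ) / 1) * ((i.1.1.L : ℝ) ^ (i.1.2.2 - i.1.2.1)) ^ 3) := fun L hL i => by
    simp only [one_mul, le_refl]
  exact stubEX_of_chartPiecesTwS55
      (fun _ => (1 : ℝ)) (fun L hL => one_pos) (fun _ => (1 : ℝ)) (fun _ => (1 : ℝ)) (fun (L : ℕ) (i : Idx L) => ((1 : ℝ) / 1) * ((i.1.1.L : ℝ) ^ (i.1.2.2 - i.1.2.1))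
      ^ 3) (fun L i => le_rfl) (1 : ℝ) hA₁' (hThm2S_of_b8Thm2AtT3Members hX 3 (by norm_num))

end Summit.QuantumFields.YangMills.Theorems.MinimiserStabilityRegPrOfB8Thm2AtT3Members

end
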